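import Mathlib
import Summits.MatrixMultiplication.MatrixMultiplication.Theorems.SnSubsetDichotomyHyperoctahedralThresholdStubGoodTwin

/-!
# `SnSubsetDichotomy.HyperoctahedralThreshold` — stub `stub_patternTwin`

Two fixed points with identical self-coincidence patterns give a clean closed rung walk (line
`refutation-local-symmetry` of crux `stmt-MatrixMultiplication-10883`, registered stub
`stub_patternTwin` of the lead's skeleton, "Stub 3e").

Setting: three involutions `μ 0, μ 1, μ 2` of `Fin n`; a colour word `z : List (Fin 3)` acts on
the right, `v · z = z.foldl (fun v c => μ c v) v` (first letter first); the trajectory of `v` is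
`t ↦ v · z.take t` on `Fin z.length`.  A family `x : Fin m → Fin n` of fixed points of `z`
(`x i · z = x i`) has *pairwise identical self-coincidence patterns* when
`x i · z.take s = x i · z.take t ↔ x j · z.take s = x j · z.take t` for all `i j s t`.
Claim: if `z` (length `ℓ ≥ 2`, cyclically reduced: `List.IsChain (· ≠ ·) (z ++ z)`) has an
injective such family of size `m ≥ 2 ℓ |R| + ℓ ^ 2 + 2`, then two of its members have
trajectories avoiding `R` and each other, and the rung walk
`t ↦ (x i₁ · z.take t, x i₂ · z.take t)` coloured by `t ↦ z[t]` is clean closed-walk data on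
`Fin (k + 1)`, `k + 1 = ℓ`: distinct endpoints on every rung, side-preserving steps, cyclically
distinct consecutive colours, pairwise equal-or-disjoint rungs, all points outside `R`.

Proof (the counting of the landed `stub_goodTwin`, whose helper lemmas are reused).  For each `t`
the map `v ↦ v · z.take t` is injective (`GoodTwin.foldl_injective`), and so is `x`; hence for
each `t < ℓ` at most `|R|` indices `i` have their `t`-th trajectory point in `R`, and at most
`ℓ · |R|` indices meet `R` at all (`Finset.card_biUnion_le_card_mul`).  Fix an `R`-free index
`i₁`.  An index `j` *crosses* `i₁` when `x j · z.take t = x i₁ · z.take s` for some `s, t < ℓ`;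
for each pair `(s, t)` there is at most one such `j`, so at most `ℓ ^ 2` indices cross `i₁`
(including `i₁` itself), and since `m - ℓ · |R| ≥ ℓ · |R| + ℓ ^ 2 + 2 > ℓ ^ 2` some `R`-free
index `i₂` does not.  Output `p t := x i₁ · z.take t`, `q t := x i₂ · z.take t`, `col t := z[t]`.
Then `p t ≠ q t` (no crossing at `s = t`); the step identity
`μ (z[t]) (v · z.take t) = v · z.take ((t + 1) % ℓ)` is `GoodTwin.foldl_take_step` (so the
side-preserving disjunct always holds); consecutive colours differ cyclically by
`GoodTwin.cyclic_ne`; and for rungs `s, t`: if `p s = p t` then `q s = q t` by the identical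
patterns of `x i₁` and `x i₂` (EQUAL), else `q s ≠ q t` by the same equivalence and the two
cross-inequalities hold because `i₂` does not cross `i₁` (DISJOINT).  `Fin (k + 1)`-successors
are read through `Fin.val_add`.
-/

set_option linter.dupNamespace false

namespace Summit.MatrixMultiplication.MatrixMultiplication.Theorems.HyperoctahedralThreshold

open Equiv

namespace PatternTwin

/-- In `Fin (k + 1)`, the successor `i + 1` has value `(i + 1) % (k + 1)`. [folklore] -/
theorem val_add_one {k : ℕ} (i : Fin (k + 1)) :
    ((i + 1 : Fin (k + 1)) : ℕ) = ((i : ℕ) + 1) % (k + 1) := by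
  rw [Fin.val_add]
  simp

end PatternTwin

/-- **Stub `stub_patternTwin` — two fixed points with identical self-coincidence patterns give a
clean closed rung walk** (line `refutation-local-symmetry` of crux
`SnSubsetDichotomy.HyperoctahedralThreshold`, stmt-MatrixMultiplication-10883, "Stub 3e").  For
three involutions `μ c` of `Fin n` and a cyclically reduced colour word `z` of length `ℓ ≥ 2`:
among `m ≥ 2 ℓ |R| + ℓ ^ 2 + 2` distinct fixed points `x i` of `z` with pairwise identical
self-coincidence patterns (`x i · z.take s = x i · z.take t ↔ x j · z.take s = x j · z.take t`)
there are two whose trajectories avoid `R` and never cross; they form clean closed-walk data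
`p t := x i₁ · z.take t`, `q t := x i₂ · z.take t`, `col t := z[t]` on `Fin (k + 1)`,
`k + 1 = ℓ`: `p t ≠ q t`, side-preserving steps (`GoodTwin.foldl_take_step`), cyclically
distinct consecutive colours (`GoodTwin.cyclic_ne`), pairwise equal-or-disjoint rungs (equal
exactly at the common self-coincidences), all points outside `R` (at most `ℓ · |R|` indices meet
`R`, at most `ℓ ^ 2` cross a fixed `R`-free `i₁`). [folklore] -/
theorem stub_patternTwin : ∀ (n : ℕ) (μ : Fin 3 → Equiv.Perm (Fin n)) (R : Finset (Fin n)) (z : List (Fin 3)) (m : ℕ) (x : Fin m → Fin n), (∀ c, μ c * μ c = 1) → 2 ≤ z.length → List.IsChain (· ≠ ·) (z ++ z) → Function.Injective x → (∀ i, z.foldl (fun v c => μ c v) (x i) = x i) → (∀ i j, ∀ s t : Fin z.length, ((z.take (s : ℕ)).foldl (fun v c => μ c v) (x i) = (z.take (t : ℕ)).foldl (fun v c => μ c v) (x i) ↔ (z.take (s : ℕ)).foldl (fun v c => μ c v) (x j) = (z.take (t : ℕ)).foldl (fun v c => μ c v) (x j))) → 2 * (z.length * R.card) + z.length ^ 2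 + 2 ≤ m → ∃ (k : ℕ) (p q : Fin (k + 1) → Fin n) (col : Fin (k + 1) → Fin 3), (∀ i, p i ≠ q i) ∧ (∀ i, (μ (col i) (p i) = p (i + 1) ∧ μ (col i) (q i) = q (i + 1)) ∨ (μ (col i) (p i) = q (i + 1) ∧ μ (col i) (q i) = p (i + 1))) ∧ (∀ i, col i ≠ col (i + 1)) ∧ (∀ i j, (p i = p j ∧ q i = q j) ∨ (p i = q j ∧ q i = p j) ∨ (p i ≠ p j ∧ p i ≠ q j ∧ q i ≠ p j ∧ q i ≠ q j)) ∧ (∀ i, p i ∉ R ∧ q i ∉ R) ∧ k + 1 = z.length := by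
  intro n μ R z m x _ hlen hchain hx hfix hpat hm
  classical
  -- at a fixed time `t` the trajectory points `x i · z.take t` are pairwise distinct
  have hTi : ∀ t, Function.Injective fun i => (z.take t).foldl (fun v c => μ c v) (x i) :=
    fun t a b h => hx (GoodTwin.foldl_injective μ (z.take t) h)
  -- (1) at most `ℓ |R|` indices have a trajectory point in `R`
  obtain ⟨Bad, hBad_mem, hBad⟩ : ∃ Bad : Finset (Fin m),
      (∀ i, i ∉ Bad → ∀ t < z.length, (z.take t).foldl (fun v c => μ c v) (x i) ∉ R) ∧
      Bad.card ≤ z.length * R.card := by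
    refine ⟨(Finset.range z.length).biUnion fun t =>
        Finset.univ.filter fun i => (z.take t).foldl (fun v c => μ c v) (x i) ∈ R, ?_, ?_⟩
    · intro i hi t ht hR
      exact hi (Finset.mem_biUnion.2
        ⟨t, Finset.mem_range.2 ht, Finset.mem_filter.2 ⟨Finset.mem_univ _, hR⟩⟩)
    · calc _ ≤ (Finset.range z.length).card * R.card :=
            Finset.card_biUnion_le_card_mul _ _ _ fun t _ =>
              Finset.card_le_card_of_injOn (fun i => (z.take t).foldl (fun v c => μ c v) (x i))
                (fun i hi => (Finset.mem_filter.1 (Finset.mem_coe.1 hi)).2) (hTi t).injOn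
        _ = z.length * R.card := by rw [Finset.card_range]
  have hGood : z.length * R.card + z.length ^ 2 + 2 ≤ (Finset.univ \ Bad).card := by
    have h := Finset.card_sdiff_add_card_eq_card (Finset.subset_univ Bad)
    rw [Finset.card_univ, Fintype.card_fin] at h
    omega
  -- (2) an `R`-free index `i₁`; at most `ℓ ^ 2` indices cross it
  obtain ⟨i₁, hi₁⟩ : (Finset.univ \ Bad).Nonempty := Finset.card_pos.1 (by omega)
  have hi₁B : i₁ ∉ Bad := (Finset.mem_sdiff.1 hi₁).2
  obtain ⟨Cross, hCross_mem, hCross⟩ : ∃ Cross : Finset (Fin m),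
      (∀ j, j ∉ Cross → ∀ s < z.length, ∀ t < z.length,
        (z.take t).foldl (fun v c => μ c v) (x j) ≠ (z.take s).foldl (fun v c => μ c v) (x i₁)) ∧
      Cross.card ≤ z.length ^ 2 := by
    refine ⟨(Finset.range z.length ×ˢ Finset.range z.length).biUnion fun st =>
        Finset.univ.filter fun j =>
          (z.take st.2).foldl (fun v c => μ c v) (x j) =
            (z.take st.1).foldl (fun v c => μ c v) (x i₁), ?_, ?_⟩
    · intro j hj s hs t ht h
      exact hj (Finset.mem_biUnion.2 ⟨(s, t),
        Finset.mem_product.2 ⟨Finset.mem_range.2 hs, Finset.mem_range.2 ht⟩,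
        Finset.mem_filter.2 ⟨Finset.mem_univ _, h⟩⟩)
    · calc _ ≤ (Finset.range z.length ×ˢ Finset.range z.length).card * 1 :=
            Finset.card_biUnion_le_card_mul _ _ _ fun st _ =>
              Finset.card_le_one.2 fun a ha b hb =>
                hTi st.2 (((Finset.mem_filter.1 ha).2).trans ((Finset.mem_filter.1 hb).2).symm)
        _ = z.length ^ 2 := by rw [Finset.card_product, Finset.card_range, mul_one, sq]
  obtain ⟨i₂, hi₂G, hi₂C⟩ : ∃ i₂, i₂ ∈ Finset.univ \ Bad ∧ i₂ ∉ Cross :=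
    Finset.exists_mem_notMem_of_card_lt_card (by omega)
  have hi₂B : i₂ ∉ Bad := (Finset.mem_sdiff.1 hi₂G).2
  -- (3) the output, indexed by `Fin (k + 1)` with `k + 1 = ℓ`
  obtain ⟨k, hk⟩ : ∃ k, k + 1 = z.length := ⟨z.length - 1, by omega⟩
  have hlt : ∀ i : Fin (k + 1), (i : ℕ) < z.length := fun i => i.isLt.trans_eq hk
  have hval : ∀ i : Fin (k + 1), ((i + 1 : Fin (k + 1)) : ℕ) = ((i : ℕ) + 1) % z.length :=
    fun i => by
      rw [PatternTwin.val_add_one]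
      exact congrArg (fun N => ((i : ℕ) + 1) % N) hk
  refine ⟨k, fun i => (z.take i).foldl (fun v c => μ c v) (x i₁),
    fun i => (z.take i).foldl (fun v c => μ c v) (x i₂), fun i => z[(i : ℕ)]'(hlt i),
    ?_, ?_, ?_, ?_, ?_, hk⟩
  · -- the two endpoints of every rung differ: `i₂` does not cross `i₁` at `s = t`
    intro i h
    exact hCross_mem i₂ hi₂C i (hlt i) i (hlt i) h.symm
  · -- the colour `z[t]` maps rung `t` onto rung `t + 1`, side-preservingly
    intro i
    refine Or.inl ⟨?_, ?_⟩
    · show μ (z[(i : ℕ)]'(hlt i)) ((z.take i).foldl (fun v c => μ c v) (x i₁)) =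
        (z.take ((i + 1 : Fin (k + 1)) : ℕ)).foldl (fun v c => μ c v) (x i₁)
      rw [hval i]
      exact GoodTwin.foldl_take_step μ z (x i₁) (hfix i₁) i (hlt i)
    · show μ (z[(i : ℕ)]'(hlt i)) ((z.take i).foldl (fun v c => μ c v) (x i₂)) =
        (z.take ((i + 1 : Fin (k + 1)) : ℕ)).foldl (fun v c => μ c v) (x i₂)
      rw [hval i]
      exact GoodTwin.foldl_take_step μ z (x i₂) (hfix i₂) i (hlt i)
  · -- consecutive colours differ, cyclically
    intro i
    exact GoodTwin.cyclic_ne hchain i _ (hlt i) (hlt (i + 1)) (hval i)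
  · -- rungs are pairwise equal or disjoint
    intro i j
    have hiff := hpat i₁ i₂ ⟨i, hlt i⟩ ⟨j, hlt j⟩
    by_cases h : (z.take i).foldl (fun v c => μ c v) (x i₁) =
        (z.take j).foldl (fun v c => μ c v) (x i₁)
    · -- a common self-coincidence of `x i₁` and (identical patterns) of `x i₂`: equal rungs
      exact Or.inl ⟨h, hiff.1 h⟩
    · -- otherwise the rungs are disjoint: no self-coincidence on either side, no crossing
      refine Or.inr (Or.inr ⟨h, ?_, ?_, fun h' => h (hiff.2 h')⟩)
      · exact fun h' => hCross_mem i₂ hi₂C i (hlt i) j (hlt j) h'.symm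
      · exact hCross_mem i₂ hi₂C j (hlt j) i (hlt i)
  · -- both trajectories avoid `R`
    intro i
    exact ⟨hBad_mem i₁ hi₁B i (hlt i), hBad_mem i₂ hi₂B i (hlt i)⟩

end Summit.MatrixMultiplication.MatrixMultiplication.Theorems.HyperoctahedralThreshold
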